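import Summits.AtomisticToContinuum.BoseEinsteinCondensation.Theorems.BECStronglyRayleighLatticeToPeriodicBridgeMuffinTinDeepWellFreeReadout
import Summits.AtomisticToContinuum.BoseEinsteinCondensation.Theorems.BECStronglyRayleighLatticeToPeriodicBridgeMuffinTinLatticeReadout
import HarnessLib

/-!
# Route `BECStronglyRayleigh`, crux `LatticeToPeriodicBridge` (stmt-AtomisticToContinuum-9674),
# line `muffin-tin-reward-supermodularity` — S2' decomposition, file 4/5: the hard-core profile's readout;
# (P3) `ProfileReadout` proved

Fourth file of the worker decomposition of `Sig.stub_deepWellCondensateLimit` (see `…MuffinTinDeepWellProfiles.lean`).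
* Combinatorics: the double count `Σ_{|T|=n} Σ_{x∉T} G(T∪{x}) = (n+1) Σ_{|S|=n+1} G(S)` and
  **functions versus subsets**, `Σ_{f : Fin N → α} G(im f) = N! Σ_{|S|=N} G(S)` for `G` supported on `N`-sets
  (`DeepWell.sum_fun_image_eq`, induction on `N` via `Fin.consEquiv`);
* HARD-CORE readout on the sector `S³ = N - M³/2` (amplitudes live on `N`-sets,
  `LatticeCoherence.apply_ind_eq_zero_of_card_ne`): `hardCoreProfile ψ` is normalised for normalised `ψ`
  (`lintegral_hardCoreProfile_sq`), `a(φ₀)` contracts the first particle into `consAmp`, which on the sector is the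
  insertion sum `Σ_{a∉T} ψ(1_{T∪{a}})`, whence `n₀(hardCoreProfile ψ) = z_w cohSum(ψ)/M³`
  (`condensateOccupation_hardCoreProfile`; `|⟨φ₀,u_x⟩|² = L⁻³ wellOverlap² = z_w/M³`);
* `profileReadout : ProfileReadout` — (P3) of the decomposition is a theorem.
Registered sub-goal: `profileReadout` (signature `ProfileReadout`).
-/

noncomputable section

namespace Summit.AtomisticToContinuum.BoseEinsteinCondensation.Cruxes.LatticeToPeriodicBridge.MuffinTinRewardSupermodularity

open MeasureTheory Filter Set
open scoped ENNReal NNReal BigOperators Topology ComplexConjugate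
open Literature.MathematicalPhysics.QuantumManyBody.BoseGas
open Literature.MathematicalPhysics.QuantumLattice
open Literature.Probability.LatticeModels (TorusSite)
open Summit.AtomisticToContinuum.BoseEinsteinCondensation.Theses
open Summit.AtomisticToContinuum.BoseEinsteinCondensation.Theses.BECStronglyRayleigh
open Summit.AtomisticToContinuum.BoseEinsteinCondensation.Theorems

namespace DeepWell

/-! ## Combinatorics: functions `Fin N → α` versus `N`-subsets -/

section Comb

variable {α : Type*} [Fintype α] [DecidableEq α]

/-- Double count `(T, x ∉ T) ↔ (S = T ∪ {x}, x ∈ S)` between `n`-sets and `(n+1)`-sets. [folklore] -/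
theorem sum_powersetCard_sum_sdiff_insert (n : ℕ) (G : Finset α → ℝ) :
    ∑ T ∈ (Finset.univ : Finset α).powersetCard n, ∑ x ∈ Finset.univ \ T, G (insert x T) =
      ((n : ℝ) + 1) * ∑ S ∈ (Finset.univ : Finset α).powersetCard (n + 1), G S := by
  -- rewrite both sides as `Σ_x Σ_{sets}` with filters
  have hL : ∑ T ∈ (Finset.univ : Finset α).powersetCard n, ∑ x ∈ Finset.univ \ T, G (insert x T) =
      ∑ x, ∑ T ∈ ((Finset.univ : Finset α).powersetCard n).filter (fun T => x ∉ T), G (insert x T) := by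
    rw [Finset.sum_comm' (t' := Finset.univ)
      (s' := fun x => ((Finset.univ : Finset α).powersetCard n).filter (fun T => x ∉ T))]
    intro T x
    simp only [Finset.mem_sdiff, Finset.mem_univ, true_and, Finset.mem_filter, and_true]
  have hR : ((n : ℝ) + 1) * ∑ S ∈ (Finset.univ : Finset α).powersetCard (n + 1), G S =
      ∑ x, ∑ S ∈ ((Finset.univ : Finset α).powersetCard (n + 1)).filter (fun S => x ∈ S), G S := by
    rw [Finset.mul_sum, Finset.sum_comm' (t' := (Finset.univ : Finset α).powersetCard (n + 1))
      (s' := fun S => S)]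
    · refine Finset.sum_congr rfl fun S hS => ?_
      rw [Finset.sum_const, nsmul_eq_mul, (Finset.mem_powersetCard.mp hS).2]
      push_cast
      ring
    · intro S x
      simp only [Finset.mem_filter, Finset.mem_univ, true_and]
      exact and_comm
  rw [hL, hR]
  refine Finset.sum_congr rfl fun x _ => ?_
  refine Finset.sum_nbij' (insert x) (fun S => S.erase x) ?_ ?_ ?_ ?_ ?_
  · intro T hT
    simp only [Finset.mem_filter, Finset.mem_powersetCard] at hT ⊢
    refine ⟨⟨Finset.subset_univ _, ?_⟩, Finset.mem_insert_self x T⟩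
    rw [Finset.card_insert_of_notMem hT.2, hT.1.2]
  · intro S hS
    simp only [Finset.mem_filter, Finset.mem_powersetCard] at hS ⊢
    refine ⟨⟨Finset.subset_univ _, ?_⟩, Finset.notMem_erase x S⟩
    rw [Finset.card_erase_of_mem hS.2, hS.1.2, Nat.add_sub_cancel]
  · intro T hT
    simp only [Finset.mem_filter] at hT
    exact Finset.erase_insert hT.2
  · intro S hS
    simp only [Finset.mem_filter] at hS
    exact Finset.insert_erase hS.2
  · intro T _
    rfl

omit [Fintype α] in
/-- Readout computation helper. [folklore] -/
theorem image_cons {n : ℕ} (x : α) (g : Fin n → α) :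
    (Finset.univ : Finset (Fin (n + 1))).image (Fin.cons x g : Fin (n + 1) → α) =
      insert x (Finset.univ.image g) := by
  ext y
  simp [Finset.mem_image, Fin.exists_fin_succ, eq_comm]

/-- **Functions versus subsets.** For `G` supported on `N`-sets,
`Σ_{f : Fin N → α} G(im f) = N! Σ_{|S| = N} G(S)` (only injective `f` contribute, `N!` per set). [folklore] -/
theorem sum_fun_image_eq :
    ∀ (N : ℕ) (G : Finset α → ℝ), (∀ S, S.card ≠ N → G S = 0) →
      ∑ f : Fin N → α, G (Finset.univ.image f) =
        (N.factorial : ℝ) * ∑ S ∈ (Finset.univ : Finset α).powersetCard N, G S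
  | 0, G, _ => by simp [Finset.powersetCard_zero]
  | n + 1, G, hG => by
    -- peel off the value at `0`
    rw [← (Fin.consEquiv fun _ => α).sum_comp]
    simp only [Fin.consEquiv, Equiv.coe_fn_mk, Fintype.sum_prod_type, image_cons]
    -- for each tail `g`, only `x ∉ im g` contributes
    set H : Finset α → ℝ := fun T => ∑ x ∈ Finset.univ \ T, G (insert x T) with hH
    have hstep : ∀ g : Fin n → α, ∑ x, G (insert x (Finset.univ.image g)) = H (Finset.univ.image g) := by
      intro g
      have hcard : (Finset.univ.image g).card ≠ n + 1 := by
        have := Finset.card_image_le (s := Finset.univ) (f := g)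
        rw [Finset.card_univ, Fintype.card_fin] at this
        omega
      rw [hH, ← Finset.sum_sdiff (Finset.subset_univ (Finset.univ.image g))]
      have h2 : ∑ x ∈ Finset.univ.image g, G (insert x (Finset.univ.image g)) = 0 := by
        refine Finset.sum_eq_zero fun x hx => ?_
        rw [Finset.insert_eq_of_mem hx]
        exact hG _ hcard
      rw [h2, add_zero]
    have hHsupp : ∀ T : Finset α, T.card ≠ n → H T = 0 := by
      intro T hT
      refine Finset.sum_eq_zero fun x hx => hG _ ?_
      rw [Finset.card_insert_of_notMem (Finset.mem_sdiff.mp hx).2]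
      omega
    rw [Finset.sum_comm]
    simp_rw [hstep]
    rw [sum_fun_image_eq n H hHsupp, hH]
    simp only
    rw [sum_powersetCard_sum_sdiff_insert n G, Nat.factorial_succ]
    push_cast
    ring

end Comb

/-! ## Hard-core profile: norm and condensate occupation -/

section HardCoreReadout

variable {M : ℕ} [NeZero M] {L w : ℝ} {N : ℕ} {ψ : TensorIndex (TorusSite 3 M) 2 → ℂ}

/-- Sector support: occupation amplitudes live on `N`-sets. [folklore] -/
theorem apply_occInd_eq_zero_of_card_ne (N : ℕ) (hsec : ψ ∈ spinZSector 1 ((N : ℝ) - (M : ℝ) ^ 3 / 2))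
    (S : Finset (TorusSite 3 M)) (hS : S.card ≠ N) : ψ (occInd S) = 0 := by
  have hcard := InsertionFieldDelocalisation.Negative.card_torusSite 3 M
  exact LatticeCoherence.apply_ind_eq_zero_of_card_ne N (by rw [hcard]; push_cast; ring) hsec S hS

/-- Readout computation helper. [folklore] -/
theorem sum_norm_occInd_sq (N : ℕ) (hsec : ψ ∈ spinZSector 1 ((N : ℝ) - (M : ℝ) ^ 3 / 2))
    (hnorm : ∑ σ, ‖ψ σ‖ ^ 2 = 1) :
    ∑ S ∈ (Finset.univ : Finset (TorusSite 3 M)).powersetCard N, ‖ψ (occInd S)‖ ^ 2 = 1 := by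
  rw [Finset.sum_subset (Finset.subset_univ _) fun S _ hS => by
    rw [apply_occInd_eq_zero_of_card_ne N hsec S (by simpa [Finset.mem_powersetCard] using hS)]; simp]
  rw [← hnorm, LatticeCoherence.sum_config_eq_sum_finset (fun σ => ‖ψ σ‖ ^ 2)]
  rfl

/-- **The hard-core profile is normalised** on the cell (for a normalised sector-`N` vector). [folklore] -/
theorem lintegral_hardCoreProfile_sq (hL : 0 < L) (hw0 : 0 < w) (hw1 : w < 1)
    (hsec : ψ ∈ spinZSector 1 ((N : ℝ) - (M : ℝ) ^ 3 / 2)) (hnorm : ∑ σ, ‖ψ σ‖ ^ 2 = 1) :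
    ∫⁻ X in cellN N L, (‖hardCoreProfile M L w N ψ X‖₊ : ℝ≥0∞) ^ 2 = 1 := by
  rw [lintegral_cellN_nnnorm_sq_eq_ofReal L continuous_hardCoreProfile,
    setIntegral_eq_integral_of_forall_compl_eq_zero fun X hX => by
      rw [hardCoreProfile_eq_zero hL hw0 hw1 hX, norm_zero, zero_pow two_ne_zero],
    integral_norm_hardCoreProfile_sq hL hw0 hw1,
    sum_fun_image_eq N (fun S => ‖ψ (occInd S)‖ ^ 2) fun S hS => by
      simp [apply_occInd_eq_zero_of_card_ne N hsec S hS],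
    sum_norm_occInd_sq N hsec hnorm, mul_one, inv_mul_cancel₀ (by positivity), ENNReal.ofReal_one]

variable {n : ℕ}

omit [NeZero M] in
/-- Readout computation helper. [folklore] -/
theorem basisFun_cons (a : TorusSite 3 M) (g : Fin n → TorusSite 3 M) (x : Space) (Y : Config n) :
    basisFun (N := n + 1) M L w (Fin.cons a g) (Matrix.vecCons x Y) = wellMode M L w a x * basisFun M L w g Y := by
  unfold basisFun
  rw [Fin.prod_univ_succ]
  simp

/-- Readout computation helper. [folklore] -/
theorem hardCoreProfile_vecCons (x : Space) (Y : Config n) :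
    hardCoreProfile M L w (n + 1) ψ (Matrix.vecCons x Y) =
      ((Real.sqrt ((n + 1).factorial : ℝ))⁻¹ : ℂ) *
        ∑ a : TorusSite 3 M, ∑ g : Fin n → TorusSite 3 M,
          ψ (occInd (insert a (Finset.univ.image g))) * ((wellMode M L w a x : ℂ) * (basisFun M L w g Y : ℂ)) := by
  unfold hardCoreProfile
  congr 1
  rw [← (Fin.consEquiv fun _ => TorusSite 3 M).sum_comp]
  simp only [Fin.consEquiv, Equiv.coe_fn_mk, Fintype.sum_prod_type, image_cons]
  refine Finset.sum_congr rfl fun a _ => Finset.sum_congr rfl fun g _ => ?_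
  rw [basisFun_cons]
  push_cast
  ring

/-- Readout computation helper. [folklore] -/
theorem setIntegral_cell_wellMode (hL : 0 < L) (hw0 : 0 < w) (hw1 : w < 1) (a : TorusSite 3 M) :
    ∫ x in cell L, (wellMode M L w a x : ℂ) = (wellOverlap M L w : ℂ) := by
  rw [setIntegral_eq_integral_of_forall_compl_eq_zero fun x hx => by
      rw [wellMode_eq_zero hL hw0 hw1 a hx, Complex.ofReal_zero],
    integral_complex_ofReal, integral_wellMode hL hw0 hw1]
  rfl

/-- Readout computation helper. [folklore] -/
theorem setIntegral_cell_conj_constantMode_mul_hardCoreProfile (hL : 0 < L) (hw0 : 0 < w) (hw1 : w < 1)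
    (Y : Config n) :
    ∫ x in cell L, conj (constantMode L x) * hardCoreProfile M L w (n + 1) ψ (Matrix.vecCons x Y) =
      ((Real.sqrt (L ^ 3))⁻¹ : ℂ) * ((Real.sqrt ((n + 1).factorial : ℝ))⁻¹ : ℂ) * (wellOverlap M L w : ℂ) *
        ∑ g : Fin n → TorusSite 3 M, consAmp ψ g * (basisFun M L w g Y : ℂ) := by
  rw [setIntegral_cell_conj_constantMode_mul]
  simp_rw [hardCoreProfile_vecCons]
  rw [integral_const_mul]
  -- swap the integral with the double sum
  have hint : ∀ (a : TorusSite 3 M) (g : Fin n → TorusSite 3 M),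
      ∫ x in cell L, ψ (occInd (insert a (Finset.univ.image g))) *
          ((wellMode M L w a x : ℂ) * (basisFun M L w g Y : ℂ)) =
        ψ (occInd (insert a (Finset.univ.image g))) * (basisFun M L w g Y : ℂ) * (wellOverlap M L w : ℂ) := by
    intro a g
    have h1 : (fun x => ψ (occInd (insert a (Finset.univ.image g))) *
        ((wellMode M L w a x : ℂ) * (basisFun M L w g Y : ℂ))) =
        fun x => (ψ (occInd (insert a (Finset.univ.image g))) * (basisFun M L w g Y : ℂ)) *
          (wellMode M L w a x : ℂ) := by
      funext x; ring
    rw [h1, integral_const_mul, setIntegral_cell_wellMode hL hw0 hw1]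
  have hcont : ∀ (a : TorusSite 3 M) (g : Fin n → TorusSite 3 M), Continuous fun x : Space =>
      ψ (occInd (insert a (Finset.univ.image g))) * ((wellMode M L w a x : ℂ) * (basisFun M L w g Y : ℂ)) :=
    fun a g => continuous_const.mul ((Complex.continuous_ofReal.comp (continuous_wellMode a)).mul continuous_const)
  rw [integral_finsetSum _ fun a _ => integrableOn_cell (continuous_finsetSum _ fun g _ => hcont a g)]
  rw [Finset.sum_congr rfl fun a _ => integral_finsetSum _ fun g _ => integrableOn_cell (hcont a g)]
  simp_rw [hint]
  rw [Finset.sum_comm]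
  unfold consAmp
  simp only [Finset.mul_sum, Finset.sum_mul]
  refine Finset.sum_congr rfl fun g _ => Finset.sum_congr rfl fun a _ => ?_
  ring

/-- On the sector, `d_g` is the insertion sum over `a ∉ im g`. [folklore] -/
theorem consAmp_eq (hsec : ψ ∈ spinZSector 1 (((n + 1 : ℕ) : ℝ) - (M : ℝ) ^ 3 / 2)) (g : Fin n → TorusSite 3 M) :
    consAmp ψ g = ∑ a ∈ Finset.univ \ Finset.univ.image g, ψ (occInd (insert a (Finset.univ.image g))) := by
  unfold consAmp
  rw [← Finset.sum_sdiff (Finset.subset_univ (Finset.univ.image g))]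
  have hcard : (Finset.univ.image g).card ≠ n + 1 := by
    have := Finset.card_image_le (s := Finset.univ) (f := g)
    rw [Finset.card_univ, Fintype.card_fin] at this
    omega
  have h2 : ∑ a ∈ Finset.univ.image g, ψ (occInd (insert a (Finset.univ.image g))) = 0 := by
    refine Finset.sum_eq_zero fun a ha => ?_
    rw [Finset.insert_eq_of_mem ha]
    exact apply_occInd_eq_zero_of_card_ne (n + 1) hsec _ hcard
  rw [h2, add_zero]

/-- `Σ_g ‖d_g‖² = n! · cohSum ψ (n+1)` on the sector. [folklore] -/
theorem sum_norm_consAmp_sq (hsec : ψ ∈ spinZSector 1 (((n + 1 : ℕ) : ℝ) - (M : ℝ) ^ 3 / 2)) :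
    ∑ g : Fin n → TorusSite 3 M, ‖consAmp ψ g‖ ^ 2 = (n.factorial : ℝ) * cohSum ψ (n + 1) := by
  simp_rw [consAmp_eq hsec]
  rw [sum_fun_image_eq n (fun T => ‖∑ a ∈ Finset.univ \ T, ψ (occInd (insert a T))‖ ^ 2) fun T hT => by
    rw [Finset.sum_eq_zero fun a ha => apply_occInd_eq_zero_of_card_ne (n + 1) hsec _ (by
      rw [Finset.card_insert_of_notMem (Finset.mem_sdiff.mp ha).2]; omega)]
    simp]
  unfold cohSum
  rw [Nat.add_sub_cancel]

/-- Readout computation helper. [folklore] -/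
theorem continuous_sum_consAmp_mul_basisFun :
    Continuous fun Y : Config n => ∑ g : Fin n → TorusSite 3 M, consAmp ψ g * (basisFun M L w g Y : ℂ) :=
  continuous_finsetSum _ fun g _ => continuous_const.mul (Complex.continuous_ofReal.comp (continuous_basisFun g))

/-- Readout computation helper. [folklore] -/
theorem lintegral_sum_consAmp_mul_basisFun_sq (hL : 0 < L) (hw0 : 0 < w) (hw1 : w < 1) :
    ∫⁻ Y in cellN n L, (‖∑ g : Fin n → TorusSite 3 M, consAmp ψ g * (basisFun M L w g Y : ℂ)‖₊ : ℝ≥0∞) ^ 2 =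
      ENNReal.ofReal (∑ g : Fin n → TorusSite 3 M, ‖consAmp ψ g‖ ^ 2) := by
  rw [lintegral_cellN_nnnorm_sq_eq_ofReal L continuous_sum_consAmp_mul_basisFun,
    setIntegral_eq_integral_of_forall_compl_eq_zero fun Y hY => by
      rw [Finset.sum_eq_zero fun g _ => by rw [basisFun_eq_zero hL hw0 hw1 g hY]; simp, norm_zero,
        zero_pow two_ne_zero]]
  simp_rw [norm_sum_mul_basisFun_sq hL hw0 hw1]
  rw [integral_finsetSum _ fun g _ => (integrable_basisFun_sq hL hw0 hw1 g).const_mul _]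
  congr 1
  refine Finset.sum_congr rfl fun g _ => ?_
  rw [integral_const_mul, integral_basisFun_sq hL hw0 hw1, mul_one]

/-- **Condensate occupation of the hard-core profile**: `n₀ = z_w cohSum(ψ)/M³`. [folklore] -/
theorem condensateOccupation_hardCoreProfile (hL : 0 < L) (hw0 : 0 < w) (hw1 : w < 1)
    (hsec : ψ ∈ spinZSector 1 (((n + 1 : ℕ) : ℝ) - (M : ℝ) ^ 3 / 2)) :
    condensateOccupation (n + 1) L (hardCoreProfile M L w (n + 1) ψ) =
      ENNReal.ofReal (deepShare w / (M : ℝ) ^ 3 * cohSum ψ (n + 1)) := by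
  have hM : (0 : ℝ) < M := by exact_mod_cast Nat.pos_of_ne_zero (NeZero.ne M)
  set C : ℝ := Real.sqrt ((n : ℝ) + 1) * ((Real.sqrt (L ^ 3))⁻¹ * ((Real.sqrt ((n + 1).factorial : ℝ))⁻¹ *
    wellOverlap M L w)) with hCdef
  have hmode : ∀ Y : Config n, modeAn L (constantMode L) (hardCoreProfile M L w (n + 1) ψ) Y =
      (C : ℂ) * ∑ g : Fin n → TorusSite 3 M, consAmp ψ g * (basisFun M L w g Y : ℂ) := by
    intro Y
    unfold modeAn
    rw [setIntegral_cell_conj_constantMode_mul_hardCoreProfile hL hw0 hw1, hCdef]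
    push_cast
    ring
  rw [condensateOccupation_eq_lintegral_modeAn_constantMode]
  simp_rw [hmode, coe_nnnorm_mul_sq]
  rw [lintegral_const_mul' _ _ (ENNReal.pow_ne_top ENNReal.coe_ne_top),
    lintegral_sum_consAmp_mul_basisFun_sq hL hw0 hw1, sum_norm_consAmp_sq hsec, coe_nnnorm_sq_eq_ofReal,
    ← ENNReal.ofReal_mul (by positivity)]
  congr 1
  -- the scalar algebra
  rw [Complex.norm_real, Real.norm_eq_abs, sq_abs]
  have hC2 : C ^ 2 = Real.sqrt ((n : ℝ) + 1) ^ 2 * (Real.sqrt (L ^ 3) ^ 2)⁻¹ *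
      (Real.sqrt ((n + 1).factorial : ℝ) ^ 2)⁻¹ * wellOverlap M L w ^ 2 := by
    rw [hCdef]; ring
  rw [hC2, Real.sq_sqrt (by positivity), Real.sq_sqrt (by positivity), Real.sq_sqrt (by positivity)]
  set ℓ : ℝ := (1 - w) * (L / M) with hℓdef
  have hℓ : 0 < ℓ := mul_pos (by linarith) (div_pos hL hM)
  have hA : Real.sqrt (2 / ℓ) ^ 2 = 2 / ℓ := Real.sq_sqrt (by positivity)
  have hW : wellOverlap M L w ^ 2 = (2 / ℓ) ^ 3 * (2 * ℓ / Real.pi) ^ 6 := by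
    unfold wellOverlap
    rw [← hℓdef]
    calc ((Real.sqrt (2 / ℓ) * (2 * ℓ / Real.pi)) ^ 3) ^ 2
        = (Real.sqrt (2 / ℓ) ^ 2) ^ 3 * (2 * ℓ / Real.pi) ^ 6 := by ring
      _ = (2 / ℓ) ^ 3 * (2 * ℓ / Real.pi) ^ 6 := by rw [hA]
  have hfact : ((n + 1).factorial : ℝ) = (n + 1) * n.factorial := by
    rw [Nat.factorial_succ]; push_cast; ring
  rw [hW, hfact]
  unfold deepShare
  rw [hℓdef]
  field_simp
  ring

end HardCoreReadout

end DeepWell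

open DeepWell

/-! ## (P3) is a theorem; the registered sub-goal of this file -/

/-- **Registered sub-goal `profileReadout`** (S2' decomposition, file 4/5): **(P3) `ProfileReadout` is a theorem** —
the explicit profiles are normalised on the cell, `n₀(freeProfile) = z_w N` and `n₀(hardCoreProfile ψ) = z_w cohSum(ψ)/M³`
on the normalised `N`-sector. [folklore] -/
theorem profileReadout : ProfileReadout := by
  intro M _ L w hL hw0 hw1 N hN
  obtain ⟨n, rfl⟩ : ∃ n, N = n + 1 := ⟨N - 1, by omega⟩
  refine ⟨⟨lintegral_freeProfile_sq hL hw0 hw1, ?_⟩, fun ψ hsec hnorm => ⟨?_, ?_⟩⟩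
  · rw [condensateOccupation_freeProfile hL hw0 hw1 n]
    push_cast
    rfl
  · exact lintegral_hardCoreProfile_sq hL hw0 hw1 hsec hnorm
  · exact condensateOccupation_hardCoreProfile hL hw0 hw1 hsec

end Summit.AtomisticToContinuum.BoseEinsteinCondensation.Cruxes.LatticeToPeriodicBridge.MuffinTinRewardSupermodularity

end
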